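import Summits.HodgeConjecture.HodgeCM.Model.TowerFixed
import Summits.HodgeConjecture.HodgeCM.PerL34.UnitaryClassNumber
import Literature.NumberTheory.Automorphic.Liu2021.Def411AsPrinted
import Literature.RepresentationTheory.Semisimple.EquivariantIrreducibleDecomposition
import HarnessLib

/-!
# The tower `H = colim_K H¹(X_K(ℂ); ℂ)` is an ADMISSIBLE representation of `U(V)(𝔸_{L₀,f})`

Fan A, binder `h413` ([Liu 2021, Prop. 4.13]), junction «Matsushima at the pin» split (a): «`H¹_{B,τ'}(A_∞, ℂ)` is an admissible
representation of `𝔾(𝔸_F^∞)`» ([Liu2021] §4.2 l. 2081), i.e. `dim_ℂ H^K < ∞` for every open compact `K` — PROVED at the tree's tower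
(`Model/TowerCarrier`) for every hermitian space `V` over a CM field `L` with `[L:ℚ] ≠ 2`:

* §1 `adelicFin_eq_Ufin` — the two finite-adelic unitary groups of the tree coincide (`HermSpace3.adelicFin V`, vendored
  `UnitaryGroup.finAdelic`, and `PerL34.AdelicUnitaryFactorisation.Ufin L V.Hm`): same carrier `{g | ((c ⊗ 1) g)ᵀ H g = H}`;
  `finite_doubleCoset_range_ρ` — **finiteness of the class set** `U(V)(L₀)\U(V)(𝔸_{L₀,f})/K` for every open `K`, in the currency of the
  tower (`(ρ V).range`, `Model/TowerLevel`), transported from `HermSpace3.finite_doubleCoset_ratFin` (Godement compactness,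
  `PerL34/UnitaryClassNumber`);
* §2 `finite_towerLevel` — `H_K = towerLevel Γ` is finite-dimensional: a family `c ∈ H_K` is determined by its values at representatives
  of the finitely many classes (`c h = t_γ^* c(γ_f h k)`), each value lying in the finite-dimensional `H¹(P_h(ℂ); ℚ) ⊗ ℂ` (`Universe.instFinite`);
* §3 `Level.ofOpenCompactLe` — an open compact `K ≤ K(Γ₀)` is the compact open of a level; `isAdmissibleRep_ofModule'_tower` — for every
  open compact `K ≤ U(V)(𝔸_{L₀,f})` the `K`-fixed vectors of the tower (`= levelImage` of the level `K ∩ K_f(3)`, `TowerFixed`) are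
  finite-dimensional: **`Liu2021.IsAdmissibleRep (Representation.ofModule' (Tower … V))`**, which at the PIN is `IsAdmissibleRep (P.rhoB τ')`
  for the `h413` datum `P = 𝕌_V.prop413Data H`.

HC_CM is proved only modulo the 7 printed citations until rung 0 closes; this file discharges none of them (it proves split (a) of the
junction «Matsushima at the pin»).
-/

noncomputable section

open scoped Pointwise
open NumberField IsDedekindDomain
open Literature.AlgebraicGeometry.HodgeTheory
open Literature.NumberTheory.Automorphic
open Literature.NumberTheory.Automorphic.PicardCM
open Literature.NumberTheory.Transcendental (Arapura2012_Cor_15_4_6)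
open HodgeCM.Adelic HodgeCM.PerL34.AdelicUnitaryFactorisation HodgeCM.PerL34.Godement

namespace HodgeCM

/-! ## §1 The class set of `U(V)` in the currency of the tower -/

namespace HermSpace3

variable {L : CMField} {ι₁ : L →+* ℂ} (V : HermSpace3 L ι₁)

/-- The two finite-adelic unitary groups of the tree agree: `V.adelicFin = Ufin L V.Hm` (both are
`{g ∈ GL₃(𝔸_{L,f}) | ((c ⊗ 1) g)ᵀ · H · g = H}`). [folklore] -/
theorem adelicFin_eq_Ufin : V.adelicFin = Ufin (L : Type) V.Hm := by
  ext g
  rw [mem_Ufin_iff]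
  rfl

/-- The identification as a group isomorphism `U(V)(𝔸_{L₀,f}) ≃* Ufin L V.Hm` (identity on matrices). [folklore] -/
def adelicFinEquivUfin : ↥V.adelicFin ≃* ↥(Ufin (L : Type) V.Hm) :=
  MulEquiv.subgroupCongr (adelicFin_eq_Ufin V)

/-- (underlying matrices are unchanged) [folklore] -/
@[simp] theorem coe_adelicFinEquivUfin (g : V.adelicFin) :
    ((adelicFinEquivUfin V g : Ufin (L : Type) V.Hm) : GL (Fin 3) (FiniteAdeleRing (𝓞 L) L)) = g := rfl

/-- (underlying matrices are unchanged) [folklore] -/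
@[simp] theorem coe_adelicFinEquivUfin_symm (g : Ufin (L : Type) V.Hm) :
    (((adelicFinEquivUfin V).symm g : V.adelicFin) : GL (Fin 3) (FiniteAdeleRing (𝓞 L) L)) = g := rfl

/-- The identification is continuous. [folklore] -/
theorem continuous_adelicFinEquivUfin : Continuous (adelicFinEquivUfin V) :=
  Continuous.subtype_mk continuous_subtype_val _

/-- Its inverse is continuous. [folklore] -/
theorem continuous_adelicFinEquivUfin_symm : Continuous (adelicFinEquivUfin V).symm :=
  Continuous.subtype_mk continuous_subtype_val _

/-- The rational points of the factorisation file land in the range of the tower's diagonal `ρ V : U(V)(L₀) →* U(V)(𝔸_{L₀,f})`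
(both are «rational unitary matrices read in `GL₃(𝔸_{L,f})`»). [folklore] -/
theorem adelicFinEquivUfin_symm_mem_range_ρ {q : Ufin (L : Type) V.Hm} (hq : q ∈ ratFin L V.Hm) :
    (adelicFinEquivUfin V).symm q ∈ (Model.TowerLevel.ρ V).range := by
  obtain ⟨γ, hγ, rfl⟩ := Subgroup.mem_map.mp hq
  obtain ⟨g₀, hg₀, hγg⟩ := (HodgeCM.Adelic.mem_adelicUnitaryRat_iff (L : Type) V.Hm γ).mp hγ
  refine ⟨⟨g₀, hg₀⟩, ?_⟩
  apply Subtype.ext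
  apply Units.ext
  rw [coe_adelicFinEquivUfin_symm, finProj_apply, val_splitEquiv_snd, ← hγg, HodgeCM.Adelic.val_toAdeleGL, Matrix.map_map]
  rfl

/-- **Finiteness of the class set `U(V)(L₀)\U(V)(𝔸_{L₀,f})/K`** for every OPEN subgroup `K`, in the currency of the tower
(`Model.TowerLevel.ρ V = U(V)(L₀) → U(V)(𝔸_{L₀,f})`): transported from `HermSpace3.finite_doubleCoset_ratFin` (Borel's finiteness of class
numbers, here from Godement compactness of the anisotropic `U(V)`, `[L:ℚ] ≠ 2`). [folklore] -/
theorem finite_doubleCoset_range_ρ (hL : Module.finrank ℚ L ≠ 2) (K : Subgroup V.adelicFin) (hK : IsOpen (K : Set V.adelicFin)) :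
    Finite (DoubleCoset.Quotient (((Model.TowerLevel.ρ V).range : Subgroup V.adelicFin) : Set V.adelicFin) (K : Set V.adelicFin)) := by
  classical
  set e := adelicFinEquivUfin V with he
  let Kf : Subgroup (Ufin (L : Type) V.Hm) := K.map e.toMonoidHom
  have hKf_mem : ∀ y, y ∈ Kf ↔ e.symm y ∈ K := fun y => Subgroup.mem_map_equiv
  have hKf : IsOpen (Kf : Set (Ufin (L : Type) V.Hm)) := by
    have hset : (Kf : Set (Ufin (L : Type) V.Hm)) = e.symm ⁻¹' (K : Set V.adelicFin) := by
      ext y; exact hKf_mem y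
    rw [hset]
    exact hK.preimage (continuous_adelicFinEquivUfin_symm V)
  haveI := HodgeCM.HermSpace3.finite_doubleCoset_ratFin (L := L) V hL Kf hKf
  let f : DoubleCoset.Quotient (ratFin L V.Hm : Set (Ufin (L : Type) V.Hm)) (Kf : Set (Ufin (L : Type) V.Hm)) →
      DoubleCoset.Quotient (((Model.TowerLevel.ρ V).range : Subgroup V.adelicFin) : Set V.adelicFin) (K : Set V.adelicFin) :=
    Quotient.lift (fun g => DoubleCoset.mk _ K (e.symm g)) (by
      intro a b hab
      obtain ⟨q, hq, k, hk, rfl⟩ := DoubleCoset.rel_iff.mp hab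
      refine (DoubleCoset.eq _ _ _ _).mpr ⟨e.symm q, adelicFinEquivUfin_symm_mem_range_ρ V hq, e.symm k, (hKf_mem k).mp hk, ?_⟩
      rw [map_mul, map_mul])
  refine Finite.of_surjective f fun x => ?_
  obtain ⟨h, rfl⟩ := x.exists_rep
  refine ⟨DoubleCoset.mk _ _ (e h), ?_⟩
  show DoubleCoset.mk _ _ (e.symm (e h)) = _
  rw [e.symm_apply_apply]

end HermSpace3

/-! ## §2 `H_K = towerLevel Γ` is finite-dimensional -/

namespace Model.TowerCarrier

open HodgeCM.Model.TowerLevel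

variable (hHD : exists_isReal_hodgeModel) (hI : hodgePQ_independent_of_hodgeModel)
  (hU : BallQuotientUniformisedDatum) (h₃ : CMAbelianVarietyRealised) (hA : Arapura2012_Cor_15_4_6)
variable {L : CMField} {ι₁ : L →+* ℂ} (V : HermSpace3 L ι₁)

/-- **`H_K = H¹(X_K(ℂ); ℂ)` is finite-dimensional** (`[L:ℚ] ≠ 2`): the equivariant families `c ∈ towerLevel Γ` are determined by their values
at representatives of the finitely many classes `U(V)(L₀)\U(V)(𝔸_{L₀,f})/K` (`c h = t_γ^* c(γ_f h k)`), and each value lives in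
`H¹(P_h(ℂ); ℚ) ⊗ ℂ`, finite-dimensional (`Universe.instFinite`). [cite: Liu2021, §4.2 l. 2081] -/
theorem finite_towerLevel (hL : Module.finrank ℚ L ≠ 2) (Γ : Level V) (hΓ : Γ.BelowConjThree) :
    Module.Finite ℂ (towerLevel hHD hI hU h₃ hA Γ hΓ) := by
  classical
  haveI := HermSpace3.finite_doubleCoset_range_ρ V hL Γ.K Γ.isOpen_K
  let Q := DoubleCoset.Quotient (((ρ V).range : Subgroup V.adelicFin) : Set V.adelicFin) (Γ.K : Set V.adelicFin)
  let ev : towerLevel hHD hI hU h₃ hA Γ hΓ →ₗ[ℂ] (∀ q : Q, W hHD hI hU h₃ Γ hΓ q.out) :=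
    { toFun := fun c q => (c : Π h, W hHD hI hU h₃ Γ hΓ h) q.out
      map_add' := fun c d => rfl
      map_smul' := fun a c => rfl }
  refine Module.Finite.of_injective ev fun c d hcd => ?_
  apply Subtype.ext
  funext h
  obtain ⟨γ', k, hγ', hk, hout⟩ := DoubleCoset.mk_out_eq_mul ((ρ V).range) Γ.K h
  obtain ⟨γ, rfl⟩ := MonoidHom.mem_range.mp hγ'
  have r : Rel Γ γ h ((DoubleCoset.mk ((ρ V).range) Γ.K h : Q).out) := ⟨k, hk, hout⟩
  have hq : (c : Π h, W hHD hI hU h₃ Γ hΓ h) ((DoubleCoset.mk ((ρ V).range) Γ.K h : Q).out) =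
      (d : Π h, W hHD hI hU h₃ Γ hΓ h) ((DoubleCoset.mk ((ρ V).range) Γ.K h : Q).out) :=
    congrFun hcd (DoubleCoset.mk ((ρ V).range) Γ.K h)
  rw [apply_eq_trPull hHD hI hU h₃ hA c r (transCond_of_rel hΓ r), apply_eq_trPull hHD hI hU h₃ hA d r (transCond_of_rel hΓ r), hq]

/-- Hence the image `levelImage Γ` of `H_K` in the tower is finite-dimensional. [cite: Liu2021, §4.2 l. 2081] -/
theorem finite_levelImage (hL : Module.finrank ℚ L ≠ 2) (Γ : Level V) (hΓ : Γ.BelowConjThree) :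
    Module.Finite ℂ (levelImage hHD hI hU h₃ hA Γ hΓ) := by
  haveI := finite_towerLevel hHD hI hU h₃ hA V hL Γ hΓ
  exact Module.Finite.range _

end Model.TowerCarrier

/-! ## §3 Admissibility -/

namespace Level

variable {L : CMField} {ι₁ : L →+* ℂ} {V : HermSpace3 L ι₁}

/-- **The level of an open compact subgroup below a given level**: for `K ≤ K(Γ₀)` open compact, the pair `(U(V)(L₀) ∩ K, K)` is a level
(torsion-freeness is inherited from `Γ₀` along `U(L₀) ∩ K ≤ U(L₀) ∩ K(Γ₀)`). [folklore] -/
def ofOpenCompactLe (K : Subgroup V.adelicFin) (hKo : IsOpen (K : Set V.adelicFin)) (hKc : IsCompact (K : Set V.adelicFin))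
    (Γ₀ : Level V) (hle : K ≤ Γ₀.K) : Level V where
  Γ := UnitaryGroup.arithmeticLevel (↥(maximalRealSubfield L)) L (IsCMField.complexConj L) 3 V.Hm K
  K := K
  isCompact_K := hKc
  isOpen_K := hKo
  arithmeticLevel_K := rfl
  torsionFree γ hγ hfin := by
    have hγ' : γ ∈ Γ₀.Γ := by
      rw [← Γ₀.arithmeticLevel_K]
      exact UnitaryGroup.arithmeticLevel_mono hle hγ
    exact Γ₀.torsionFree γ hγ' hfin

/-- (the compact open of `ofOpenCompactLe K …` is `K`) [folklore] -/
@[simp] theorem K_ofOpenCompactLe (K : Subgroup V.adelicFin) (hKo : IsOpen (K : Set V.adelicFin))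
    (hKc : IsCompact (K : Set V.adelicFin)) (Γ₀ : Level V) (hle : K ≤ Γ₀.K) :
    (ofOpenCompactLe K hKo hKc Γ₀ hle).K = K := rfl

/-- `ofOpenCompactLe K … Γ₀ _ ≤ Γ₀`. [folklore] -/
theorem ofOpenCompactLe_le (K : Subgroup V.adelicFin) (hKo : IsOpen (K : Set V.adelicFin))
    (hKc : IsCompact (K : Set V.adelicFin)) (Γ₀ : Level V) (hle : K ≤ Γ₀.K) :
    ofOpenCompactLe K hKo hKc Γ₀ hle ≤ Γ₀ := Level.le_def.mpr hle

end Level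

namespace Model.TowerCarrier

open HodgeCM.Model.TowerLevel

variable (hHD : exists_isReal_hodgeModel) (hI : hodgePQ_independent_of_hodgeModel)
  (hU : BallQuotientUniformisedDatum) (h₃ : CMAbelianVarietyRealised) (hA : Arapura2012_Cor_15_4_6)
variable {L : CMField} {ι₁ : L →+* ℂ} (V : HermSpace3 L ι₁)

/-- **The tower is ADMISSIBLE** ([Liu2021] §4.2 l. 2081, READING I2 second half, at the tree's tower; `[L:ℚ] ≠ 2`): for every open compact
`K ≤ U(V)(𝔸_{L₀,f})` the `K`-fixed vectors of `H = colim_K H¹(X_K(ℂ); ℂ)` are finite-dimensional — they are fixed by `K ∩ K_f(3)`, the compact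
open of a level `Γ'` below `K_f(3)`, hence lie in `levelImage Γ'` (`TowerFixed.mem_levelImage_iff`), which is finite-dimensional
(`finite_levelImage`).  The representation is `Representation.ofModule'` of the `ℂ[U(V)(𝔸_f)]`-module `Tower … V` (`TowerAlgebra`), i.e. the
field `rhoB τ'` of the `h413` datum `𝕌_V.prop413Data H`. [cite: Liu2021, §4.2 l. 2081] -/
theorem isAdmissibleRep_ofModule'_tower (hL : Module.finrank ℚ L ≠ 2) :
    Liu2021.IsAdmissibleRep (G := ↥V.adelicFin) (V := Tower hHD hI hU h₃ hA V)
      (Representation.ofModule' (k := ℂ) (G := ↥V.adelicFin) (Tower hHD hI hU h₃ hA V)) := by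
  rintro K ⟨hKo, hKc⟩
  -- shrink `K` to an open compact below `K_f(3)`
  let K' : Subgroup V.adelicFin := K ⊓ (Level.three V).K
  have hK'o : IsOpen (K' : Set V.adelicFin) := hKo.inter (Level.three V).isOpen_K
  have hK'c : IsCompact (K' : Set V.adelicFin) :=
    (Level.three V).isCompact_K.of_isClosed_subset (Subgroup.isClosed_of_isOpen K' hK'o) Set.inter_subset_right
  let Γ' : Level V := Level.ofOpenCompactLe K' hK'o hK'c (Level.three V) inf_le_right
  have hΓ' : Γ'.BelowConjThree := Level.belowConjThree_of_le_three (Level.ofOpenCompactLe_le K' hK'o hK'c _ inf_le_right)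
  haveI hfin := finite_levelImage hHD hI hU h₃ hA V hL Γ' hΓ'
  -- the `K`-fixed vectors lie in `levelImage Γ'`
  have hle : Liu2021.fixedSubmodule (V := Tower hHD hI hU h₃ hA V)
      (Representation.ofModule' (k := ℂ) (G := ↥V.adelicFin) (Tower hHD hI hU h₃ hA V)) K ≤
        levelImage hHD hI hU h₃ hA Γ' hΓ' := by
    intro x hx
    rw [Liu2021.mem_fixedSubmodule_iff] at hx
    rw [mem_levelImage_iff hHD hI hU h₃ hA Γ' hΓ']
    intro k hk
    have h := hx k hk.1
    have e := Literature.RepresentationTheory.Semisimple.ofModule'_apply_eq_of_smul (k := ℂ) (G := ↥V.adelicFin)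
      (Tower hHD hI hU h₃ hA V) k x
    have h' : MonoidAlgebra.of ℂ (↥V.adelicFin) k • x = x := e.symm.trans h
    rwa [of_smul_eq_act] at h'
  exact @Submodule.finiteDimensional_of_le ℂ (Tower hHD hI hU h₃ hA V) _ _ _ _ _ hfin hle

end Model.TowerCarrier

end HodgeCM

end
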